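import Summits.CriticalPhenomena.PercolationContinuityZ3.Theorems.Transplant.FKDoubleFanMultifanGens
import Summits.CriticalPhenomena.PercolationContinuityZ3.Theorems.Transplant.FKDoubleFanOneSidedFinal
import HarnessLib

/-!
# Double fans, MULTIFAN₁ middles: the elementary condition `GoodIJ` at a pair of product vectors and the REDUCTION of LEMMA‴ to it
# (endpoint layer of LEMMA‴, part 2)

Helper file (`--supports stmt-CriticalPhenomena-4575`), FK sub-lane `prim-bschramm-fk-3` (gen 35); builds on p205010 (kernel theorem, internal audit
signed; external expert review pending).  Pure real algebra, no sorries; standard axioms.  Memo `bschramm/prim-bschramm-fk-3/FAR-CROSS-X.md` §1–§2.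

LEMMA‴ (`…DoubleFanMultifan`): `mfRay q F G u s := mfZ¹⁰mfZ⁰¹ − mfZ¹¹mfZ⁰⁰ ≥ 0` on `InKE⁴`.  By `…MultifanForm` and `…MultifanGens`,
`mfRay = q²·pairH (target bivector) (input bivector)`, all four legs are affine along the fibres of their apex frames, and at the endpoint shapes of
the two fan legs the two bivectors are non-negative combinations of the six generators `genA, genN, genCone, genCtwo, genDg, genR q t w` of the
product vector `P = uprods u` (input) resp. of their `swapYZ`-mirrors at `S = sprods s` (target).  Hence (**`mfRay_nonneg_of_goodIJ`**, the four ray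
decompositions `vecB_nonneg_of_rays_gen` of `…OneSidedRays` applied in the order `u, s, F, G`, the `u`- and `s`-legs through the endpoint cone
`InEndCone` of `…OneSidedFinal`): LEMMA‴ on the relaxation `Valid ∧ U` (`0 < q < 1`) follows from the ELEMENTARY CONDITION
**`GoodIJ q P S`** — `pairH q (swapYZ γ) β ≥ 0` for every generator `β` at `P` and every generator `γ` at `S` (36 polynomial inequalities in `q` and at
most eight leg parameters) — at the 36 pairs of ENDPOINT product vectors (`IsEndP`: rays `A, D, AC, BD, 𝟙` and `roofP q t w`).  `GoodIJ` is symmetric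
(**`GoodIJ.symm`**, from `pairH_swapYZ` — the mirror symmetry of the double fan), so 21 endpoint pairs suffice; it is linear in `P` and in `S`
(**`goodIJ_of_cone`**).  **`mfRay_nonneg_inKE_of_goodIJ`** is the `InKE⁴`, `0 < q ≤ 1` form consumed by `negCorr_spokes_cross_far_of_multifan`.
[folklore]
-/

noncomputable section

namespace Summit.CriticalPhenomena.PercolationContinuityZ3.Theorems

namespace FK

namespace ThreeApex

/-! ### The four-leg Rayleigh difference -/

/-- The four-leg Rayleigh difference of a MULTIFAN₁ middle: `mfZ¹⁰·mfZ⁰¹ − mfZ¹¹·mfZ⁰⁰`. [folklore] -/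
def mfRay (q : ℝ) (F G u s : V5) : ℝ := mfZ q F G u s 1 0 * mfZ q F G u s 0 1 - mfZ q F G u s 1 1 * mfZ q F G u s 0 0

/-- `mfRay = q²·pairH (target bivector) (input bivector)`. [folklore] -/
theorem mfRay_eq_pairH (q : ℝ) (F G u s : V5) :
    mfRay q F G u s = q ^ 2 * pairH q (wedgeH (fanComboBrev q G (conv s (edgeBC 1))) (fanComboBrev q G s))
      (wedgeH (fanCombo q F (conv (edgeAC 1) u)) (fanCombo q F u)) := by
  simp only [mfRay]; exact mfZ_rayleigh_eq_pairH q F G u s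

/-- At `q = 1` the pairing vanishes identically. [folklore] -/
theorem pairH_one (β γ : Biv) : pairH 1 β γ = 0 := by
  simp only [pairH]; ring

/-- Affinity along the `u`-fibre. [folklore] -/
theorem mfRay_fibreU (q : ℝ) (F G s : V5) (W y X Z a b c : ℝ) :
    mfRay q F G (vecB q W y X Z (c * a + (1 - c) * b)) s = c * mfRay q F G (vecB q W y X Z a) s + (1 - c) * mfRay q F G (vecB q W y X Z b) s := by
  simp only [mfRay_eq_pairH, wedgeH_fanCombo_ufibre q F W y X Z a b c, pairH_comm_lin3]; ring

/-- Affinity along the `s`-fibre. [folklore] -/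
theorem mfRay_fibreS (q : ℝ) (F G u : V5) (W y X Z a b c : ℝ) :
    mfRay q F G u (swapAB (vecB q W y X Z (c * a + (1 - c) * b))) =
      c * mfRay q F G u (swapAB (vecB q W y X Z a)) + (1 - c) * mfRay q F G u (swapAB (vecB q W y X Z b)) := by
  simp only [mfRay_eq_pairH, wedgeH_fanComboBrev_sfibre q G W y X Z a b c, pairH_lin3]; ring

/-- Affinity along the `F`-fibre (`…MultifanForm`). [folklore] -/
theorem mfRay_fibreF (q : ℝ) (G u s : V5) (W y X Z a b c : ℝ) :
    mfRay q (swapAC (swapAB (vecB q W y X Z (c * a + (1 - c) * b)))) G u s =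
      c * mfRay q (swapAC (swapAB (vecB q W y X Z a))) G u s + (1 - c) * mfRay q (swapAC (swapAB (vecB q W y X Z b))) G u s :=
  mfRayleigh_fibreF_affine q G u s W y X Z a b c

/-- Affinity along the `G`-fibre (`…MultifanForm`; `legG v₀ y Z X Z₁ = swapAB (vecB q W y X Z v₀)` with `Z₁ = W − qy − X − Z`). [folklore] -/
theorem mfRay_fibreG (q : ℝ) (F u s : V5) (W y X Z a b c : ℝ) :
    mfRay q F (swapAB (vecB q W y X Z (c * a + (1 - c) * b))) u s =
      c * mfRay q F (swapAB (vecB q W y X Z a)) u s + (1 - c) * mfRay q F (swapAB (vecB q W y X Z b)) u s := by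
  have e : ∀ v0 : ℝ, swapAB (vecB q W y X Z v0) = legG v0 y Z X (W - q * y - X - Z) := by
    intro v0; ext <;> simp [swapAB, vecB, legG]
  simp only [e]
  exact mfRayleigh_fibreG_affine q F u s y X Z (W - q * y - X - Z) a b c

/-! ### Bilinearity bookkeeping -/

/-- `pairH` is additive in the second slot. [folklore] -/
theorem pairH_add_right (q : ℝ) (T β γ : Biv) : pairH q T (Biv.add β γ) = pairH q T β + pairH q T γ := by
  simp only [pairH, Biv.add]; ring

/-- `pairH` is homogeneous in the second slot. [folklore] -/
theorem pairH_smul_right (q c : ℝ) (T β : Biv) : pairH q T (Biv.smul c β) = c * pairH q T β := by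
  simp only [pairH, Biv.smul]; ring

/-- `genA` is additive. [folklore] -/
theorem genA_add (P Q : P6) : genA (P6.add P Q) = Biv.add (genA P) (genA Q) := by
  ext <;> simp only [genA, P6.add, Biv.add] <;> ring
/-- `genA` is homogeneous. [folklore] -/
theorem genA_smul (c : ℝ) (P : P6) : genA (P6.smul c P) = Biv.smul c (genA P) := by
  ext <;> simp only [genA, P6.smul, Biv.smul] <;> ring
/-- `genN` is additive. [folklore] -/
theorem genN_add (q : ℝ) (P Q : P6) : genN q (P6.add P Q) = Biv.add (genN q P) (genN q Q) := by
  ext <;> simp only [genN, P6.add, Biv.add] <;> ring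
/-- `genN` is homogeneous. [folklore] -/
theorem genN_smul (q c : ℝ) (P : P6) : genN q (P6.smul c P) = Biv.smul c (genN q P) := by
  ext <;> simp only [genN, P6.smul, Biv.smul] <;> ring
/-- `genCone` is additive. [folklore] -/
theorem genCone_add (P Q : P6) : genCone (P6.add P Q) = Biv.add (genCone P) (genCone Q) := by
  ext <;> simp only [genCone, P6.add, Biv.add] <;> ring
/-- `genCone` is homogeneous. [folklore] -/
theorem genCone_smul (c : ℝ) (P : P6) : genCone (P6.smul c P) = Biv.smul c (genCone P) := by
  ext <;> simp only [genCone, P6.smul, Biv.smul] <;> ring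
/-- `genCtwo` is additive. [folklore] -/
theorem genCtwo_add (q : ℝ) (P Q : P6) : genCtwo q (P6.add P Q) = Biv.add (genCtwo q P) (genCtwo q Q) := by
  ext <;> simp only [genCtwo, P6.add, Biv.add] <;> ring
/-- `genCtwo` is homogeneous. [folklore] -/
theorem genCtwo_smul (q c : ℝ) (P : P6) : genCtwo q (P6.smul c P) = Biv.smul c (genCtwo q P) := by
  ext <;> simp only [genCtwo, P6.smul, Biv.smul] <;> ring
/-- `genDg` is additive. [folklore] -/
theorem genDg_add (q : ℝ) (P Q : P6) : genDg q (P6.add P Q) = Biv.add (genDg q P) (genDg q Q) := by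
  ext <;> simp only [genDg, P6.add, Biv.add] <;> ring
/-- `genDg` is homogeneous. [folklore] -/
theorem genDg_smul (q c : ℝ) (P : P6) : genDg q (P6.smul c P) = Biv.smul c (genDg q P) := by
  ext <;> simp only [genDg, P6.smul, Biv.smul] <;> ring
/-- `genR` is additive. [folklore] -/
theorem genR_add (q t w : ℝ) (P Q : P6) : genR q t w (P6.add P Q) = Biv.add (genR q t w P) (genR q t w Q) := by
  ext <;> simp only [genR, P6.add, Biv.add] <;> ring
/-- `genR` is homogeneous. [folklore] -/
theorem genR_smul (q t w c : ℝ) (P : P6) : genR q t w (P6.smul c P) = Biv.smul c (genR q t w P) := by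
  ext <;> simp only [genR, P6.smul, Biv.smul] <;> ring

/-! ### Generators, the elementary condition, symmetry and linearity -/

/-- The six generator bivectors at the product vector `P` (the roof generator for every `t ≥ 0`, `w ∈ [0,1]`). [folklore] -/
inductive IsGen (q : ℝ) (P : P6) : Biv → Prop
  | A : IsGen q P (genA P)
  | N : IsGen q P (genN q P)
  | Cone : IsGen q P (genCone P)
  | Ctwo : IsGen q P (genCtwo q P)
  | Dg : IsGen q P (genDg q P)
  | R {t w : ℝ} : 0 ≤ t → 0 ≤ w → w ≤ 1 → IsGen q P (genR q t w P)

/-- **`GoodIJ q P S`**: every generator at `S`, mirrored, pairs non-negatively with every generator at `P`. [folklore] -/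
def GoodIJ (q : ℝ) (P S : P6) : Prop := ∀ β γ : Biv, IsGen q P β → IsGen q S γ → 0 ≤ pairH q (Biv.swapYZ γ) β

/-- **Symmetry** (the mirror of the double fan). [folklore] -/
theorem GoodIJ.symm {q : ℝ} {P S : P6} (h : GoodIJ q P S) : GoodIJ q S P := by
  intro β γ hβ hγ; rw [pairH_swapYZ]; exact h γ β hγ hβ

/-- Every generator is additive in `P`. [folklore] -/
theorem IsGen.split_add {q : ℝ} {P Q : P6} {β : Biv} (h : IsGen q (P6.add P Q) β) :
    ∃ β₁ β₂ : Biv, IsGen q P β₁ ∧ IsGen q Q β₂ ∧ β = Biv.add β₁ β₂ := by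
  cases h with
  | A => exact ⟨_, _, IsGen.A, IsGen.A, genA_add P Q⟩
  | N => exact ⟨_, _, IsGen.N, IsGen.N, genN_add q P Q⟩
  | Cone => exact ⟨_, _, IsGen.Cone, IsGen.Cone, genCone_add P Q⟩
  | Ctwo => exact ⟨_, _, IsGen.Ctwo, IsGen.Ctwo, genCtwo_add q P Q⟩
  | Dg => exact ⟨_, _, IsGen.Dg, IsGen.Dg, genDg_add q P Q⟩
  | R ht hw0 hw1 => exact ⟨_, _, IsGen.R ht hw0 hw1, IsGen.R ht hw0 hw1, genR_add q _ _ P Q⟩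

/-- Every generator is homogeneous in `P`. [folklore] -/
theorem IsGen.split_smul {q c : ℝ} {P : P6} {β : Biv} (h : IsGen q (P6.smul c P) β) :
    ∃ β₁ : Biv, IsGen q P β₁ ∧ β = Biv.smul c β₁ := by
  cases h with
  | A => exact ⟨_, IsGen.A, genA_smul c P⟩
  | N => exact ⟨_, IsGen.N, genN_smul q c P⟩
  | Cone => exact ⟨_, IsGen.Cone, genCone_smul c P⟩
  | Ctwo => exact ⟨_, IsGen.Ctwo, genCtwo_smul q c P⟩
  | Dg => exact ⟨_, IsGen.Dg, genDg_smul q c P⟩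
  | R ht hw0 hw1 => exact ⟨_, IsGen.R ht hw0 hw1, genR_smul q _ _ c P⟩

/-- `GoodIJ` is additive in `P`. [folklore] -/
theorem GoodIJ.add_left {q : ℝ} {P Q S : P6} (hP : GoodIJ q P S) (hQ : GoodIJ q Q S) : GoodIJ q (P6.add P Q) S := by
  intro β γ hβ hγ
  obtain ⟨β₁, β₂, h₁, h₂, rfl⟩ := hβ.split_add
  rw [pairH_add_right]; exact add_nonneg (hP _ _ h₁ hγ) (hQ _ _ h₂ hγ)

/-- `GoodIJ` is homogeneous in `P`. [folklore] -/
theorem GoodIJ.smul_left {q c : ℝ} {P S : P6} (hP : GoodIJ q P S) (hc : 0 ≤ c) : GoodIJ q (P6.smul c P) S := by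
  intro β γ hβ hγ
  obtain ⟨β₁, h₁, rfl⟩ := hβ.split_smul
  rw [pairH_smul_right]; exact mul_nonneg hc (hP _ _ h₁ hγ)

/-- `GoodIJ` is additive in `S`. [folklore] -/
theorem GoodIJ.add_right {q : ℝ} {P S T : P6} (hS : GoodIJ q P S) (hT : GoodIJ q P T) : GoodIJ q P (P6.add S T) :=
  (hS.symm.add_left hT.symm).symm

/-- `GoodIJ` is homogeneous in `S`. [folklore] -/
theorem GoodIJ.smul_right {q c : ℝ} {P S : P6} (hS : GoodIJ q P S) (hc : 0 ≤ c) : GoodIJ q P (P6.smul c S) :=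
  (hS.symm.smul_left hc).symm

/-- `GoodIJ` on all endpoint pairs extends to the endpoint cones. [folklore] -/
theorem goodIJ_of_cone {q : ℝ} (H : ∀ P S : P6, IsEndP q P → IsEndP q S → GoodIJ q P S) {P S : P6} (hP : InEndCone q P)
    (hS : InEndCone q S) : GoodIJ q P S := by
  have step : ∀ P' : P6, IsEndP q P' → GoodIJ q P' S := by
    intro P' hP'
    obtain ⟨cA, cAC, cD, cBD, c1, cR, t, w, hA, hAC, hD, hBD, h1, hR, ht, hw0, hw1, rfl⟩ := hS
    have g := fun (T : P6) (hT : IsEndP q T) => H P' T hP' hT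
    refine GoodIJ.add_right (GoodIJ.add_right (GoodIJ.add_right ?_ ?_) (GoodIJ.add_right ?_ ?_)) (GoodIJ.add_right ?_ ?_)
    · exact (g rayA (Or.inl rfl)).smul_right hA
    · exact (g rayAC (Or.inr (Or.inr (Or.inl rfl)))).smul_right hAC
    · exact (g rayD (Or.inr (Or.inl rfl))).smul_right hD
    · exact (g rayBD (Or.inr (Or.inr (Or.inr (Or.inl rfl))))).smul_right hBD
    · exact (g rayOne (Or.inr (Or.inr (Or.inr (Or.inr (Or.inl rfl)))))).smul_right h1
    · exact (g (roofP q t w) (Or.inr (Or.inr (Or.inr (Or.inr (Or.inr ⟨t, w, ht, hw0, hw1, rfl⟩)))))).smul_right hR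
  obtain ⟨cA, cAC, cD, cBD, c1, cR, t, w, hA, hAC, hD, hBD, h1, hR, ht, hw0, hw1, rfl⟩ := hP
  refine GoodIJ.add_left (GoodIJ.add_left (GoodIJ.add_left ?_ ?_) (GoodIJ.add_left ?_ ?_)) (GoodIJ.add_left ?_ ?_)
  · exact (step rayA (Or.inl rfl)).smul_left hA
  · exact (step rayAC (Or.inr (Or.inr (Or.inl rfl)))).smul_left hAC
  · exact (step rayD (Or.inr (Or.inl rfl))).smul_left hD
  · exact (step rayBD (Or.inr (Or.inr (Or.inr (Or.inl rfl))))).smul_left hBD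
  · exact (step rayOne (Or.inr (Or.inr (Or.inr (Or.inr (Or.inl rfl)))))).smul_left h1
  · exact (step (roofP q t w) (Or.inr (Or.inr (Or.inr (Or.inr (Or.inr ⟨t, w, ht, hw0, hw1, rfl⟩)))))).smul_left hR

/-! ### The generator cone and the endpoint shapes of the two fan legs -/

/-- The cone of the six generators at `P` (one roof member suffices for a single fan-leg shape). [folklore] -/
def InGenCone (q : ℝ) (P : P6) (β : Biv) : Prop :=
  ∃ cA cN c1 c2 cD cR t w : ℝ, 0 ≤ cA ∧ 0 ≤ cN ∧ 0 ≤ c1 ∧ 0 ≤ c2 ∧ 0 ≤ cD ∧ 0 ≤ cR ∧ 0 ≤ t ∧ 0 ≤ w ∧ w ≤ 1 ∧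
    β = Biv.add (Biv.add (Biv.add (Biv.smul cA (genA P)) (Biv.smul cN (genN q P))) (Biv.add (Biv.smul c1 (genCone P)) (Biv.smul c2 (genCtwo q P))))
          (Biv.add (Biv.smul cD (genDg q P)) (Biv.smul cR (genR q t w P)))

/-- `GoodIJ` gives non-negative pairings of a cone element against every generator. [folklore] -/
theorem GoodIJ.cone_left {q : ℝ} {P S : P6} (h : GoodIJ q P S) {β γ : Biv} (hβ : InGenCone q P β) (hγ : IsGen q S γ) :
    0 ≤ pairH q (Biv.swapYZ γ) β := by
  obtain ⟨cA, cN, c1, c2, cD, cR, t, w, hA, hN, h1, h2, hD, hR, ht, hw0, hw1, rfl⟩ := hβ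
  simp only [pairH_add_right, pairH_smul_right]
  have gA := h _ _ IsGen.A hγ
  have gN := h _ _ IsGen.N hγ
  have g1 := h _ _ IsGen.Cone hγ
  have g2 := h _ _ IsGen.Ctwo hγ
  have gD := h _ _ IsGen.Dg hγ
  have gR := h _ _ (IsGen.R ht hw0 hw1) hγ
  exact add_nonneg (add_nonneg (add_nonneg (mul_nonneg hA gA) (mul_nonneg hN gN)) (add_nonneg (mul_nonneg h1 g1) (mul_nonneg h2 g2)))
    (add_nonneg (mul_nonneg hD gD) (mul_nonneg hR gR))

/-- `GoodIJ` gives non-negative pairings of cone elements on both sides. [folklore] -/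
theorem GoodIJ.cone_both {q : ℝ} {P S : P6} (h : GoodIJ q P S) {β γ : Biv} (hβ : InGenCone q P β) (hγ : InGenCone q S γ) :
    0 ≤ pairH q (Biv.swapYZ γ) β := by
  obtain ⟨cA, cN, c1, c2, cD, cR, t, w, hA, hN, h1, h2, hD, hR, ht, hw0, hw1, rfl⟩ := hγ
  simp only [Biv.swapYZ_add, Biv.swapYZ_smul]
  have key : ∀ γ' : Biv, IsGen q S γ' → 0 ≤ pairH q (Biv.swapYZ γ') β := fun γ' hγ' => h.cone_left hβ hγ'
  have gA := key _ IsGen.A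
  have gN := key _ IsGen.N
  have g1 := key _ IsGen.Cone
  have g2 := key _ IsGen.Ctwo
  have gD := key _ IsGen.Dg
  have gR := key _ (IsGen.R ht hw0 hw1)
  have e : pairH q (Biv.add (Biv.add (Biv.add (Biv.smul cA (Biv.swapYZ (genA S))) (Biv.smul cN (Biv.swapYZ (genN q S))))
        (Biv.add (Biv.smul c1 (Biv.swapYZ (genCone S))) (Biv.smul c2 (Biv.swapYZ (genCtwo q S)))))
        (Biv.add (Biv.smul cD (Biv.swapYZ (genDg q S))) (Biv.smul cR (Biv.swapYZ (genR q t w S))))) β =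
      cA * pairH q (Biv.swapYZ (genA S)) β + cN * pairH q (Biv.swapYZ (genN q S)) β + c1 * pairH q (Biv.swapYZ (genCone S)) β +
        c2 * pairH q (Biv.swapYZ (genCtwo q S)) β + cD * pairH q (Biv.swapYZ (genDg q S)) β + cR * pairH q (Biv.swapYZ (genR q t w S)) β := by
    simp only [pairH, Biv.add, Biv.smul]; ring
  rw [e]
  have := mul_nonneg hA gA; have := mul_nonneg hN gN; have := mul_nonneg h1 g1; have := mul_nonneg h2 g2
  have := mul_nonneg hD gD; have := mul_nonneg hR gR
  linarith

/-- A floor-type combination of the generators lies in the cone. [folklore] -/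
theorem inGenCone_of_floor {q : ℝ} {P : P6} {cA cN c1 c2 : ℝ} (hA : 0 ≤ cA) (hN : 0 ≤ cN) (h1 : 0 ≤ c1) (h2 : 0 ≤ c2) :
    InGenCone q P (Biv.add (Biv.add (Biv.smul cA (genA P)) (Biv.smul cN (genN q P)))
      (Biv.add (Biv.smul c1 (genCone P)) (Biv.smul c2 (genCtwo q P)))) := by
  refine ⟨cA, cN, c1, c2, 0, 0, 0, 0, hA, hN, h1, h2, le_rfl, le_rfl, le_rfl, le_rfl, zero_le_one, ?_⟩
  ext <;> simp only [Biv.add, Biv.smul] <;> ring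

/-- A degenerate-type multiple of `genDg` lies in the cone. [folklore] -/
theorem inGenCone_of_deg {q : ℝ} {P : P6} {c : ℝ} (hc : 0 ≤ c) : InGenCone q P (Biv.smul c (genDg q P)) := by
  refine ⟨0, 0, 0, 0, c, 0, 0, 0, le_rfl, le_rfl, le_rfl, le_rfl, hc, le_rfl, le_rfl, le_rfl, zero_le_one, ?_⟩
  ext <;> simp only [Biv.add, Biv.smul] <;> ring

/-- A roof-type multiple of `genR q t w` lies in the cone. [folklore] -/
theorem inGenCone_of_roof {q : ℝ} {P : P6} {c t w : ℝ} (hc : 0 ≤ c) (ht : 0 ≤ t) (hw0 : 0 ≤ w) (hw1 : w ≤ 1) :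
    InGenCone q P (Biv.smul c (genR q t w P)) := by
  refine ⟨0, 0, 0, 0, 0, c, t, w, le_rfl, le_rfl, le_rfl, le_rfl, le_rfl, hc, ht, hw0, hw1, ?_⟩
  ext <;> simp only [Biv.add, Biv.smul] <;> ring

/-- Input side, degenerate fan vector (`f₀, f_ab ≥ 0`). [folklore] -/
theorem inGenCone_deg (q : ℝ) {f0 fab : ℝ} (hf0 : 0 ≤ f0) (hfab : 0 ≤ fab) (u : V5) :
    InGenCone q (uprods u) (wedgeH (fanCombo q ⟨f0, fab, 0, 0, 0⟩ (conv (edgeAC 1) u)) (fanCombo q ⟨f0, fab, 0, 0, 0⟩ u)) := by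
  rw [wedgeH_fanCombo_deg]; exact inGenCone_of_deg (by positivity)

/-- Input side, floor fan vector (masses `≥ 0`). [folklore] -/
theorem inGenCone_floor (q : ℝ) {fab fac fbc f1 : ℝ} (hfab : 0 ≤ fab) (hfac : 0 ≤ fac) (hfbc : 0 ≤ fbc) (hf1 : 0 ≤ f1) (u : V5) :
    InGenCone q (uprods u) (wedgeH (fanCombo q ⟨0, fab, fac, fbc, f1⟩ (conv (edgeAC 1) u)) (fanCombo q ⟨0, fab, fac, fbc, f1⟩ u)) := by
  rw [wedgeH_fanCombo_floor]; exact inGenCone_of_floor (by positivity) (by positivity) (by positivity) (by positivity)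

/-- Input side, roof fan vector (`κ ≥ 0`, `l > 0`, `t ≥ 0`, `w ∈ [0,1]`). [folklore] -/
theorem inGenCone_roof (q : ℝ) {κ l t w : ℝ} (hκ : 0 ≤ κ) (hl : 0 < l) (ht : 0 ≤ t) (hw0 : 0 ≤ w) (hw1 : w ≤ 1) (u : V5) :
    InGenCone q (uprods u) (wedgeH (fanCombo q (swapAC (swapAB (roofV q κ l t w))) (conv (edgeAC 1) u))
      (fanCombo q (swapAC (swapAB (roofV q κ l t w))) u)) := by
  rw [wedgeH_fanCombo_roof]; exact inGenCone_of_roof (mul_nonneg hκ hl.le) ht hw0 hw1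

/-- Target side, degenerate `b`-fan vector. [folklore] -/
theorem inGenCone_degB (q : ℝ) {g0 gbc : ℝ} (hg0 : 0 ≤ g0) (hgbc : 0 ≤ gbc) (s : V5) :
    ∃ γ : Biv, InGenCone q (sprods s) γ ∧
      wedgeH (fanComboBrev q ⟨g0, 0, 0, gbc, 0⟩ (conv s (edgeBC 1))) (fanComboBrev q ⟨g0, 0, 0, gbc, 0⟩ s) = Biv.swapYZ γ := by
  refine ⟨_, inGenCone_of_deg (q := q) (P := sprods s) (c := g0 ^ 2 + g0 * gbc) (by positivity), ?_⟩
  rw [wedgeH_fanComboBrev_deg, Biv.swapYZ_smul]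

/-- Target side, floor `b`-fan vector. [folklore] -/
theorem inGenCone_floorB (q : ℝ) {gab gac gbc g1 : ℝ} (hgab : 0 ≤ gab) (hgac : 0 ≤ gac) (hgbc : 0 ≤ gbc) (hg1 : 0 ≤ g1) (s : V5) :
    ∃ γ : Biv, InGenCone q (sprods s) γ ∧
      wedgeH (fanComboBrev q ⟨0, gab, gac, gbc, g1⟩ (conv s (edgeBC 1))) (fanComboBrev q ⟨0, gab, gac, gbc, g1⟩ s) = Biv.swapYZ γ := by
  refine ⟨_, inGenCone_of_floor (q := q) (P := sprods s) (cA := gac * (gac + g1 + gab)) (cN := gab * (gab + g1 + gac)) (c1 := gac * gbc)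
    (c2 := gab * gbc) (by positivity) (by positivity) (by positivity) (by positivity), ?_⟩
  rw [wedgeH_fanComboBrev_floor]; simp only [Biv.swapYZ_add, Biv.swapYZ_smul]

/-- Target side, roof `b`-fan vector. [folklore] -/
theorem inGenCone_roofB (q : ℝ) {κ l t w : ℝ} (hκ : 0 ≤ κ) (hl : 0 < l) (ht : 0 ≤ t) (hw0 : 0 ≤ w) (hw1 : w ≤ 1) (s : V5) :
    ∃ γ : Biv, InGenCone q (sprods s) γ ∧
      wedgeH (fanComboBrev q (swapAB (roofV q κ l t w)) (conv s (edgeBC 1))) (fanComboBrev q (swapAB (roofV q κ l t w)) s) = Biv.swapYZ γ := by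
  refine ⟨_, inGenCone_of_roof (q := q) (P := sprods s) (c := κ * l) (mul_nonneg hκ hl.le) ht hw0 hw1, ?_⟩
  rw [wedgeH_fanComboBrev_roof, Biv.swapYZ_smul]

/-! ### The reduction -/

/-- Both fan legs at endpoint shapes: `mfRay ≥ 0` from `GoodIJ` at the product vectors. [folklore] -/
theorem mfRay_nonneg_of_cones {q : ℝ} {F G u s : V5} (h : GoodIJ q (uprods u) (sprods s))
    (hF : InGenCone q (uprods u) (wedgeH (fanCombo q F (conv (edgeAC 1) u)) (fanCombo q F u)))
    (hG : ∃ γ : Biv, InGenCone q (sprods s) γ ∧ wedgeH (fanComboBrev q G (conv s (edgeBC 1))) (fanComboBrev q G s) = Biv.swapYZ γ) :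
    0 ≤ mfRay q F G u s := by
  obtain ⟨γ, hγ, e⟩ := hG
  rw [mfRay_eq_pairH, e]
  exact mul_nonneg (sq_nonneg q) (h.cone_both hF hγ)

/-- The `G`-leg against an `F`-leg at an endpoint shape. [folklore] -/
theorem mfRay_nonneg_legG {q : ℝ} (hq0 : 0 < q) (hq1 : q < 1) {F u s : V5} (h : GoodIJ q (uprods u) (sprods s))
    (hF : InGenCone q (uprods u) (wedgeH (fanCombo q F (conv (edgeAC 1) u)) (fanCombo q F u))) {G : V5} (hG : G.Nonneg)
    (hGU : UCond q G) : 0 ≤ mfRay q F G u s := by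
  have hv : (swapAB G).Nonneg := by obtain ⟨h0, h1, h2, h3, h4⟩ := hG; exact ⟨h0, h1, h3, h2, h4⟩
  have hU' : UCond q (swapAB (swapAB G)) := by rwa [swapAB_swapAB]
  have key := nonneg_of_rays_gen hq0 hq1 (Φ := fun v => mfRay q F (swapAB v) u s) (fun W y X Z a b c => mfRay_fibreG q F u s W y X Z a b c)
    (fun y u0 hu0 hyu => by
      have e : swapAB (vecB q (q * y) y 0 0 u0) = ⟨u0, 0, 0, y - u0, 0⟩ := by ext <;> simp [swapAB, vecB]
      simp only [e]
      exact mfRay_nonneg_of_cones h hF (inGenCone_degB q hu0 (sub_nonneg.2 hyu) s))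
    (fun W y X Z hX hZ hy hW h1 => by
      have e : swapAB (vecB q W y X Z 0) = ⟨0, X, Z, y, W - q * y - X - Z⟩ := by ext <;> simp [swapAB, vecB]
      simp only [e]
      exact mfRay_nonneg_of_cones h hF (inGenCone_floorB q hX hZ hy h1 s))
    (fun κ l t w hκ hl ht hw0 hw1 => mfRay_nonneg_of_cones h hF (inGenCone_roofB q hκ hl ht hw0 hw1 s)) hv hU'
  simpa only [swapAB_swapAB] using key

/-- The `F`-leg. [folklore] -/
theorem mfRay_nonneg_legF {q : ℝ} (hq0 : 0 < q) (hq1 : q < 1) {u s : V5} (h : GoodIJ q (uprods u) (sprods s)) {F G : V5} (hF : F.Nonneg)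
    (hFU : UCond q (swapAC F)) (hG : G.Nonneg) (hGU : UCond q G) : 0 ≤ mfRay q F G u s := by
  have hv : (swapAB (swapAC F)).Nonneg := by obtain ⟨h0, h1, h2, h3, h4⟩ := hF; exact ⟨h0, h3, h1, h2, h4⟩
  have hU' : UCond q (swapAB (swapAB (swapAC F))) := by rwa [swapAB_swapAB]
  have key := nonneg_of_rays_gen hq0 hq1 (Φ := fun v => mfRay q (swapAC (swapAB v)) G u s) (fun W y X Z a b c => mfRay_fibreF q G u s W y X Z a b c)
    (fun y u0 hu0 hyu => by
      simp only [fanVec_deg]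
      exact mfRay_nonneg_legG hq0 hq1 h (inGenCone_deg q hu0 (sub_nonneg.2 hyu) u) hG hGU)
    (fun W y X Z hX hZ hy hW h1 => by
      simp only [fanVec_floor]
      exact mfRay_nonneg_legG hq0 hq1 h (inGenCone_floor q hy hZ hX h1 u) hG hGU)
    (fun κ l t w hκ hl ht hw0 hw1 => mfRay_nonneg_legG hq0 hq1 h (inGenCone_roof q hκ hl ht hw0 hw1 u) hG hGU) hv hU'
  simpa only [swapAB_swapAB, swapAC_swapAC] using key

/-- **THE REDUCTION.**  If `GoodIJ q P S` holds at every pair of endpoint product vectors, then LEMMA‴ holds at `q ∈ (0,1)` on the relaxation: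
`mfRay q F G u s ≥ 0` for all `F, G, u, s` with masses `≥ 0` and `(U_c)(F)`, `(U_a)(G)`, `(U_b)(u)`, `(U_a)(s)`. [folklore] -/
theorem mfRay_nonneg_of_goodIJ {q : ℝ} (hq0 : 0 < q) (hq1 : q < 1) (H : ∀ P S : P6, IsEndP q P → IsEndP q S → GoodIJ q P S)
    {F G u s : V5} (hF : F.Nonneg) (hFU : UCond q (swapAC F)) (hG : G.Nonneg) (hGU : UCond q G) (hu : u.Nonneg)
    (huU : UCond q (swapAB u)) (hs : s.Nonneg) (hsU : UCond q s) : 0 ≤ mfRay q F G u s := by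
  have inner : ∀ u' : V5, InEndCone q (uprods u') → 0 ≤ mfRay q F G u' s := by
    intro u' hu'
    have hv : (swapAB s).Nonneg := by obtain ⟨h0, h1, h2, h3, h4⟩ := hs; exact ⟨h0, h1, h3, h2, h4⟩
    have hU' : UCond q (swapAB (swapAB s)) := by rwa [swapAB_swapAB]
    have key := nonneg_of_rays_gen hq0 hq1 (Φ := fun v => mfRay q F G u' (swapAB v)) (fun W y X Z a b c => mfRay_fibreS q F G u' W y X Z a b c)
      (fun y u0 hu0 hyu => by
        refine mfRay_nonneg_legF hq0 hq1 (goodIJ_of_cone H hu' ?_) hF hFU hG hGU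
        rw [sprods_eq, swapAB_swapAB]; exact inEndCone_deg q hu0 hyu)
      (fun W y X Z hX hZ hy hW _ => by
        refine mfRay_nonneg_legF hq0 hq1 (goodIJ_of_cone H hu' ?_) hF hFU hG hGU
        rw [sprods_eq, swapAB_swapAB]; exact inEndCone_floor q hX hZ hy hW)
      (fun κ l t w hκ hl ht hw0 hw1 => by
        refine mfRay_nonneg_legF hq0 hq1 (goodIJ_of_cone H hu' ?_) hF hFU hG hGU
        rw [sprods_eq, swapAB_swapAB]; exact inEndCone_roof q hκ hl ht hw0 hw1) hv hU'
    simpa only [swapAB_swapAB] using key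
  exact nonneg_of_rays_gen hq0 hq1 (Φ := fun v => mfRay q F G v s) (fun W y X Z a b c => mfRay_fibreU q F G s W y X Z a b c)
    (fun y u0 hu0 hyu => inner _ (inEndCone_deg q hu0 hyu)) (fun W y X Z hX hZ hy hW _ => inner _ (inEndCone_floor q hX hZ hy hW))
    (fun κ l t w hκ hl ht hw0 hw1 => inner _ (inEndCone_roof q hκ hl ht hw0 hw1)) hu huU

/-- **THE REDUCTION on `InKE⁴`, all `0 < q ≤ 1`** (at `q = 1` the form vanishes identically) — the hypothesis of
`negCorr_spokes_cross_far_of_multifan`, granted `GoodIJ` at the endpoint pairs. [folklore] -/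
theorem mfRay_nonneg_inKE_of_goodIJ {q : ℝ} (hq0 : 0 < q) (hq1 : q ≤ 1)
    (H : q < 1 → ∀ P S : P6, IsEndP q P → IsEndP q S → GoodIJ q P S) (F G u s : V5) (hF : InKE q F) (hG : InKE q G)
    (hu : InKE q u) (hs : InKE q s) : 0 ≤ mfZ q F G u s 1 0 * mfZ q F G u s 0 1 - mfZ q F G u s 1 1 * mfZ q F G u s 0 0 := by
  rw [← mfRay]
  rcases eq_or_lt_of_le hq1 with h1 | h1
  · subst h1
    rw [mfRay_eq_pairH, pairH_one, mul_zero]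
  · exact mfRay_nonneg_of_goodIJ hq0 h1 (H h1) (hF.valid hq0.le hq1).nonneg (hF.uCondC hq0 hq1) (hG.valid hq0.le hq1).nonneg
      (hG.uCond hq0 hq1) (hu.valid hq0.le hq1).nonneg (hu.uCondB hq0 hq1) (hs.valid hq0.le hq1).nonneg (hs.uCond hq0 hq1)

end ThreeApex

end FK

end Summit.CriticalPhenomena.PercolationContinuityZ3.Theorems
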